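import Summits.QuantumFields.YangMills.Theorems.OnsetCalibrationAssembly
import Summits.QuantumFields.YangMills.Theorems.OnsetCalibrationOnsetVanishes
import Summits.QuantumFields.YangMills.Theorems.OnsetCalibrationOnsetFloorsOfNT
import Summits.QuantumFields.YangMills.Theorems.LangevinControlUVOSLegsFromFemtoAndGapStubCollar6

/-!
# Route `OnsetCalibration` — the collar transfer for K2 and the route's two-input certificate

* `momentCeilings_of_boundaryOscillation` (proved; the transfer of line `dlr-collar-subonset` of crux K2
  `SubOnsetCeilings`, stmt-QuantumFields-23313, copied out of the crux skeleton so that Theorems files can use it):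
  at fixed `(β, s)`, an oscillation bound `C₁/R'⁴` for the kernel means of single-plane fields at the centres of
  femto cubes of side `2R'+3` (`(2R'+3)·s ≤ ℓ₁`) collars to `(2C₁/R⁴)ⁿ` centred mixed-moment bounds on every odd
  torus for `R·s ≤ ℓ₁/5` (one torus-DLR step per site, tree `abs_integral_prod_sub_mean_le`).
* `subOnsetCeilings_of_centredBoundaryLaw`: K2 from the registered stub `stub_centredBoundaryLaw6` (taken as a
  hypothesis, verbatim): `C = 2C₁`, `ℓ₄ = ℓ₁/5`, `β₄ = β₁`.
* `hypercubicOSData_of_NT_of_centredBoundaryLaw` — the ROUTE CERTIFICATE: the leaf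
  `InfiniteVolumeContinuum.HypercubicOSDataFromInfiniteVolume` (rung R2a-IV) follows from exactly TWO named open
  inputs, the ladder's residual `BalabanLadder.NT` and the sub-onset centred boundary law (the stub), through the
  landed `assembly_proof`, `onsetVanishes_proof`, `onsetFloors_of_NT`.

HONEST LABEL: both inputs are OPEN (NT = non-triviality residual; the boundary law = E0′ content); the certificate
is conditional; no summit and no mass gap is proved.
-/

set_option autoImplicit false

noncomputable section

open scoped SchwartzMap
open MeasureTheory Filter Topology
open Literature.MathematicalPhysics.QuantumFieldTheory Literature.MathematicalPhysics.QuantumLattice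
open Literature.MathematicalPhysics.AQFT Literature.Probability.LatticeModels
open Summit.QuantumFields.YangMills.Cruxes.OSLegsFromFemtoAndGap.DlrCollarTransfer

namespace Summit.QuantumFields.YangMills.Theorems.OnsetCalibration

/-- **One-resolution collar transfer in oscillation form (proved).**  At a fixed coupling `β` and resolution
`s > 0`: if on every centred cube of side `2R'+3` (`R' ≥ 1`, `(2R'+3)·s ≤ ℓ₁`) the kernel means of each
single-plane field at the centre oscillate over the exteriors by at most `C₁/R'⁴` around some centre, then on
every odd torus the centred mixed moments of single-plane fields at `n` sites with pairwise torus separation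
`≥ 2R+4` (`1 ≤ R`, `R·s ≤ ℓ₁/5`, `4R+8 ≤ L`) are at most `(2C₁/R⁴)ⁿ`.  One torus-DLR step per site on the radius-`R+1` cube around it (tree
`abs_integral_prod_sub_mean_le`, Georgii Thm. 4.17), observables shifted by their centres so that the common
reference value is `0`; cube/injectivity/separation geometry and the uniform bound on single-plane fields from
the landed `DlrCollarTransfer.stub_collar6` file.  The femto condition `(2R+3)·s ≤ 5R·s ≤ ℓ₁` is where
`R·s ≤ ℓ₁/5` is used. -/
theorem momentCeilings_of_boundaryOscillation {G : Type} [Group G] [TopologicalSpace G] [IsTopologicalGroup G]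
    [CompactSpace G] [MeasurableSpace G] [BorelSpace G] (r : LatticeRep G) {β C₁ ℓ₁ s : ℝ} (hs0 : 0 < s)
    (hF : ∀ (q : Fin 4 × Fin 4) (x : Fin 4 → ℤ) (R : ℕ), q.1 < q.2 → 1 ≤ R → ((2 * R + 3 : ℕ) : ℝ) * s ≤ ℓ₁ →
      ∃ m : ℝ, ∀ η : LGConfig 4 G,
        |kerE G r β (fun k => x k - (R + 1)) (2 * R + 3) η (plane G r q x) - m| ≤ C₁ / (R : ℝ) ^ 4)
    (L n : ℕ) (q : Fin n → Fin 4 × Fin 4) (x : Fin n → (Fin 4 → ℤ)) (R : ℕ) (hq : ∀ i, (q i).1 < (q i).2)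
    (hR : 1 ≤ R) (hRs : (R : ℝ) * s ≤ ℓ₁ / 5) (hRL : 4 * R + 8 ≤ L)
    (hsep : ∀ i j : Fin n, i ≠ j → ∃ k : Fin 4,
      (2 * (R : ℤ) + 4) ≤ |((((x i k - x j k : ℤ) : ZMod (2 * L + 1))).valMinAbs : ℤ)|) :
    |torusE G r β L (fun U => ∏ i, (plane G r (q i) (x i) U - torusE G r β L (plane G r (q i) (x i))))| ≤
      (2 * C₁ / (R : ℝ) ^ 4) ^ n := by
  haveI : SecondCountableTopology G :=
    (r.continuous.isClosedEmbedding r.injective).isEmbedding.secondCountableTopology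
  haveI := isProbabilityMeasure_wilsonMeasure (d := 4) (L := 2 * L + 1) r.ρ r.continuous β
  obtain ⟨CA, hCA⟩ := exists_abs_plane_le r
  -- the cubes of side `2R+3` around the sites are femto in the unit `s`
  have hb : ((2 * R + 3 : ℕ) : ℝ) * s ≤ ℓ₁ := by
    have h5 : ((2 * R + 3 : ℕ) : ℝ) ≤ 5 * R := by
      have : (1 : ℝ) ≤ R := by exact_mod_cast hR
      push_cast
      linarith
    calc ((2 * R + 3 : ℕ) : ℝ) * s ≤ 5 * R * s := mul_le_mul_of_nonneg_right h5 hs0.le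
      _ = 5 * ((R : ℝ) * s) := by ring
      _ ≤ 5 * (ℓ₁ / 5) := by gcongr
      _ = ℓ₁ := by ring
  -- the centres of the kernel means at the cube centres, one per site
  choose m hm using fun i : Fin n => hF (q i) (x i) R (hq i) hR hb
  -- the data of the abstract collar bound: volumes = supports = the cubes, observables shifted by their centres
  have hmeas : ∀ i : Fin n, Measurable (plane G r (q i) (x i)) := fun i =>
    (continuous_plane r (q i) (x i)).measurable
  have hAc : ∀ i : Fin n, Continuous fun U => plane G r (q i) (x i) U - m i := fun i =>
    (continuous_plane r (q i) (x i)).sub continuous_const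
  have hAb : ∀ (i : Fin n) (U : LGConfig 4 G), |plane G r (q i) (x i) U - m i| ≤ CA + ∑ j, |m j| :=
    fun i U => (abs_sub _ _).trans (add_le_add (hCA _ _ _)
      (Finset.single_le_sum (f := fun j => |m j|) (fun j _ => abs_nonneg _) (Finset.mem_univ i)))
  have hAS : ∀ i : Fin n, IsCylinder (fun U => plane G r (q i) (x i) U - m i)
      (Summit.QuantumFields.YangMills.Cruxes.OSLegsFromFemtoAndGap.DlrCollarTransfer.cubeEdges (fun k => x i k - (R + 1)) (2 * R + 3)) :=
    fun i U V hUV => by simp only [isCylinder_plane_cube r hR (q i) (x i) hUV]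
  have hinj : ∀ i : Fin n, Set.InjOn (Torus.proj (2 * L + 1))
      (((Summit.QuantumFields.YangMills.Cruxes.OSLegsFromFemtoAndGap.DlrCollarTransfer.cubeEdges (fun k => x i k - (R + 1)) (2 * R + 3) ∪
          Summit.QuantumFields.YangMills.Cruxes.OSLegsFromFemtoAndGap.DlrCollarTransfer.cubeEdges (fun k => x i k - (R + 1)) (2 * R + 3) ∪
          (plaquettesTouching (Summit.QuantumFields.YangMills.Cruxes.OSLegsFromFemtoAndGap.DlrCollarTransfer.cubeEdges (fun k => x i k - (R + 1))
            (2 * R + 3))).biUnion plaquetteEdges).image Prod.fst : Set (Fin 4 → ℤ))) :=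
    fun i => injOn_torusProj_cube hRL (x i)
  have hfar : ∀ i j : Fin n, i ≠ j →
      ∀ e ∈ Summit.QuantumFields.YangMills.Cruxes.OSLegsFromFemtoAndGap.DlrCollarTransfer.cubeEdges (fun k => x j k - (R + 1)) (2 * R + 3) ∪
        (plaquettesTouching (Summit.QuantumFields.YangMills.Cruxes.OSLegsFromFemtoAndGap.DlrCollarTransfer.cubeEdges (fun k => x j k - (R + 1))
          (2 * R + 3))).biUnion plaquetteEdges,
      ∀ e' ∈ Summit.QuantumFields.YangMills.Cruxes.OSLegsFromFemtoAndGap.DlrCollarTransfer.cubeEdges (fun k => x i k - (R + 1)) (2 * R + 3),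
      torusEdge (2 * L + 1) e ≠ torusEdge (2 * L + 1) e' :=
    fun i j hij e he e' he' => torusEdge_ne_cube (hsep i j hij) he he'
  have hmean : ∀ i : Fin n, torusE G r β L (plane G r (q i) (x i)) - m i =
      ∫ W, (plane G r (q i) (x i) (torusLift (2 * L + 1) W) - m i)
        ∂(wilsonMeasure (d := 4) (L := 2 * L + 1) r.ρ β) := fun i =>
    (integral_sub_const_of_abs_le (μ := wilsonMeasure (d := 4) (L := 2 * L + 1) r.ρ β)
      ((continuous_plane r (q i) (x i)).comp (continuous_torusLift (2 * L + 1))).measurable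
      (fun W => hCA (q i) (x i) (torusLift (2 * L + 1) W)) (m i)).symm
  have hker : ∀ (i : Fin n) (η : LGConfig 4 G),
      |(∫ U, (plane G r (q i) (x i) U - m i) ∂(ymSpecification r.ρ β
        (Summit.QuantumFields.YangMills.Cruxes.OSLegsFromFemtoAndGap.DlrCollarTransfer.cubeEdges (fun k => x i k - (R + 1)) (2 * R + 3)) η)) - 0| ≤
        C₁ / (R : ℝ) ^ 4 := fun i η => by
    haveI := isProbabilityMeasure_ymSpecification r.ρ r.continuous β
      (Summit.QuantumFields.YangMills.Cruxes.OSLegsFromFemtoAndGap.DlrCollarTransfer.cubeEdges (fun k => x i k - (R + 1)) (2 * R + 3)) η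
    rw [sub_zero, integral_sub_const_of_abs_le (hmeas i) (fun U => hCA (q i) (x i) U) (m i)]
    exact hm i η
  have key : |∫ V, ∏ i, (plane G r (q i) (x i) (torusLift (2 * L + 1) V) - m i -
      (torusE G r β L (plane G r (q i) (x i)) - m i)) ∂(wilsonMeasure (d := 4) (L := 2 * L + 1) r.ρ β)| ≤
      (2 * (C₁ / (R : ℝ) ^ 4)) ^ n :=
    abs_integral_prod_sub_mean_le (d := 4) r.ρ r.continuous β (L := 2 * L + 1) (n := n)
      (fun i => Summit.QuantumFields.YangMills.Cruxes.OSLegsFromFemtoAndGap.DlrCollarTransfer.cubeEdges (fun k => x i k - (R + 1)) (2 * R + 3))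
      (fun i => Summit.QuantumFields.YangMills.Cruxes.OSLegsFromFemtoAndGap.DlrCollarTransfer.cubeEdges (fun k => x i k - (R + 1)) (2 * R + 3))
      (fun i U => plane G r (q i) (x i) U - m i) hAc hAb hAS hinj hfar
      (fun i => torusE G r β L (plane G r (q i) (x i)) - m i) hmean hker
  simp only [sub_sub_sub_cancel_right] at key
  rw [show (2 : ℝ) * C₁ / (R : ℝ) ^ 4 = 2 * (C₁ / (R : ℝ) ^ 4) from mul_div_assoc _ _ _]
  exact key


/-- **K2 from the centred boundary law** (the registered stub `stub_centredBoundaryLaw6` of line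
`dlr-collar-subonset`, taken as the hypothesis `hBL`): constants `C = 2C₁`, `ℓ₄ = ℓ₁/5`, `β₄ = β₁`. -/
theorem subOnsetCeilings_of_centredBoundaryLaw
    (hBL : ∀ (G : Type) [Group G] [TopologicalSpace G] [IsTopologicalGroup G] [CompactSpace G],
      IsCompactSimpleLieGroup G → Nonempty (G ≃ₜ* Matrix.specialUnitaryGroup (Fin 2) ℂ) →
      letI : MeasurableSpace G := borel G
      haveI : BorelSpace G := ⟨rfl⟩
      ∀ (r : LatticeRep G) (v f g h : 𝓢(EuclideanSpace ℝ (Fin 4), ℝ)) (Λ₅ : ℝ),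
        ∃ ε₀ : ℝ, 0 < ε₀ ∧ ∀ ε : ℝ, 0 < ε → ε ≤ ε₀ →
          (∃ β₅ : ℝ, ∀ β : ℝ, β₅ ≤ β → ∃ s : ℝ, 0 < s ∧ s ≤ 1 ∧
            (∀ L : ℕ, Λ₅ ≤ s * L → ε ≤ Q2 G r β L s (thetaTest 4 v) v) ∧
            (∀ L : ℕ, Λ₅ ≤ s * L → ε ≤ |Q3 G r β L s f g h|)) →
          ∃ (C₁ ℓ₁ β₁ : ℝ), 0 < ℓ₁ ∧ 0 ≤ C₁ ∧ ∀ β : ℝ, β₁ ≤ β → ∀ s : ℝ, 0 < s → s ≤ 1 →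
            (∀ s' : ℝ, 2 * s ≤ s' → s' ≤ 1 →
              ¬ ((∀ L : ℕ, Λ₅ ≤ s' * L → ε ≤ Q2 G r β L s' (thetaTest 4 v) v) ∧
                 (∀ L : ℕ, Λ₅ ≤ s' * L → ε ≤ |Q3 G r β L s' f g h|))) →
            ∀ (q : Fin 4 × Fin 4) (x : Fin 4 → ℤ) (R : ℕ), q.1 < q.2 → 1 ≤ R →
              ((2 * R + 3 : ℕ) : ℝ) * s ≤ ℓ₁ →
                ∃ m : ℝ, ∀ η : LGConfig 4 G,
                  |kerE G r β (fun k => x k - (R + 1)) (2 * R + 3) η (plane G r q x) - m| ≤ C₁ / (R : ℝ) ^ 4) :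
    Summit.QuantumFields.YangMills.Theses.OnsetCalibration.SubOnsetCeilings := by
  unfold Summit.QuantumFields.YangMills.Theses.OnsetCalibration.SubOnsetCeilings
  intro G _ _ _ _ hG hcl
  letI : MeasurableSpace G := borel G
  haveI : BorelSpace G := ⟨rfl⟩
  intro r v f g h Λ₅
  obtain ⟨ε₀, hε₀, hBL'⟩ := hBL G hG hcl r v f g h Λ₅
  refine ⟨ε₀, hε₀, fun ε hε hεle hlive => ?_⟩
  obtain ⟨C₁, ℓ₁, β₁, hℓ₁, hC₁, hF⟩ := hBL' ε hε hεle hlive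
  refine ⟨2 * C₁, ℓ₁ / 5, β₁, by positivity, by positivity, ?_⟩
  intro β hβ s hs0 hs1 hsub L n q x R hq hR hRs hRL hsep
  exact momentCeilings_of_boundaryOscillation r hs0 (hF β hβ s hs0 hs1 hsub) L n q x R hq hR hRs hRL hsep

/-- **Route certificate**: rung R2a-IV (the leaf `HypercubicOSDataFromInfiniteVolume`) from the two named open
inputs `BalabanLadder.NT` and the sub-onset centred boundary law, through the landed Assembly, U and the
K1-from-NT bridge.  Conditional; proves no summit. -/
theorem hypercubicOSData_of_NT_of_centredBoundaryLaw
    (hNT : Summit.QuantumFields.YangMills.Theses.BalabanLadder.NT)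
    (hBL : ∀ (G : Type) [Group G] [TopologicalSpace G] [IsTopologicalGroup G] [CompactSpace G],
      IsCompactSimpleLieGroup G → Nonempty (G ≃ₜ* Matrix.specialUnitaryGroup (Fin 2) ℂ) →
      letI : MeasurableSpace G := borel G
      haveI : BorelSpace G := ⟨rfl⟩
      ∀ (r : LatticeRep G) (v f g h : 𝓢(EuclideanSpace ℝ (Fin 4), ℝ)) (Λ₅ : ℝ),
        ∃ ε₀ : ℝ, 0 < ε₀ ∧ ∀ ε : ℝ, 0 < ε → ε ≤ ε₀ →
          (∃ β₅ : ℝ, ∀ β : ℝ, β₅ ≤ β → ∃ s : ℝ, 0 < s ∧ s ≤ 1 ∧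
            (∀ L : ℕ, Λ₅ ≤ s * L → ε ≤ Q2 G r β L s (thetaTest 4 v) v) ∧
            (∀ L : ℕ, Λ₅ ≤ s * L → ε ≤ |Q3 G r β L s f g h|)) →
          ∃ (C₁ ℓ₁ β₁ : ℝ), 0 < ℓ₁ ∧ 0 ≤ C₁ ∧ ∀ β : ℝ, β₁ ≤ β → ∀ s : ℝ, 0 < s → s ≤ 1 →
            (∀ s' : ℝ, 2 * s ≤ s' → s' ≤ 1 →
              ¬ ((∀ L : ℕ, Λ₅ ≤ s' * L → ε ≤ Q2 G r β L s' (thetaTest 4 v) v) ∧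
                 (∀ L : ℕ, Λ₅ ≤ s' * L → ε ≤ |Q3 G r β L s' f g h|))) →
            ∀ (q : Fin 4 × Fin 4) (x : Fin 4 → ℤ) (R : ℕ), q.1 < q.2 → 1 ≤ R →
              ((2 * R + 3 : ℕ) : ℝ) * s ≤ ℓ₁ →
                ∃ m : ℝ, ∀ η : LGConfig 4 G,
                  |kerE G r β (fun k => x k - (R + 1)) (2 * R + 3) η (plane G r q x) - m| ≤ C₁ / (R : ℝ) ^ 4) :
    Summit.QuantumFields.YangMills.Theses.InfiniteVolumeContinuum.HypercubicOSDataFromInfiniteVolume :=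
  assembly_proof (subOnsetCeilings_of_centredBoundaryLaw hBL) (onsetFloors_of_NT hNT) onsetVanishes_proof

end Summit.QuantumFields.YangMills.Theorems.OnsetCalibration

end
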